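import Summits.CriticalPhenomena.Ising3D.Control2DTail
import Mathlib.Analysis.Convex.SpecificFunctions.Basic
import Mathlib.Analysis.Convex.Slope
import Mathlib.Tactic.Linarith
import Mathlib.Tactic.Positivity
import Mathlib.Tactic.Ring
import Mathlib.Tactic.FieldSimp
import HarnessLib

/-!
# The 2D control: the log-free second-order cell scheme for obligation (M) — proved
(cell `pub-ising3x`, seat controls-1; mathematics of the kernel checker `Control2DMidCheck.lean`)

HONEST FRAMING: lottery ticket; floor = tightest certified 3D Ising CFT bounds; no exact-solution
claim without a proof.

Obligation (M) of a 2D point-functional gap certificate asks `φ[F_-[x^a y^b + x^b y^a]] ≥ 0` for all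
real `a, b ≥ 0` with `E₀ ≤ a + b < Δ⋆` and `a - b ∈ ℤ` — in the variables `E = a + b`, `j = |a - b|`
a CONTINUUM in `E` for each of finitely many `j`. At a point functional with nodes `(z_k, z̄_k)` and
weights `w_k` (external dimension `1/8`) this is `Φ_j(E) = Σ_d σ_d f_d(E) ≥ 0`, the sum running over
the `2K` evaluation data `d` (direct `(x,y) = (z_k, z̄_k)` with coefficient `w_k v_k^{1/8}`, reflected
`(1-z_k, 1-z̄_k)` with `-w_k u_k^{1/8}`), `σ_d = ±1` the sign and
`f_d(E) = |c_d| (x_d^j + y_d^j) (x_d y_d)^{(E-j)/2} ≥ 0` — each `f_d` is CONVEX in `E` (an exponential).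
Verifier A bounds `Φ_j` on cells by order-2 Taylor forms, verifier B by exponential minorants; both
need logarithms. The kernel scheme proved here needs only VALUES of the `f_d` at grid points: on a
cell `[c, c+H]`, with `F = Σ_{σ=+} f_d` and `G = Σ_{σ=-} f_d` (both convex),
`F(E) ≥ F(c+H) + θ (F(c+H) - F(c+2H))` (three-slope inequality, `θ = (c+H-E)/H ∈ [0,1]`) and
`G(E) ≤ θ G(c) + (1-θ) G(c+H)` (chord), so `Φ_j ≥ 0` on the cell as soon as
`F(c+H) ≥ G(c+H)` and `2F(c+H) ≥ F(c+2H) + G(c)` (`cell_nonneg_of_convex`) — two inequalities between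
non-negative numbers that the interval checker decides. This file: the term `fM` and its convexity,
the signed sums `Fpos`/`Fneg`/`Phi` over a list of real evaluation data `RDat`, the cell lemma, the
covering lemmas (unit cells and their dyadic refinements), and the identification
`φ[F_-[pairPow a b]] = Phi (realData w z z̄) |a-b| (a+b)`.

References: verifier obligations (M) of `HOME/code/controls/rb0/verify_points2d.py` /
`checkB_points2d.py` (pub-ising3x controls-1 gen 3); convexity: Mathlib `convexOn_rpow_left`,
`ConvexOn.secant_mono_aux1`/`slope_mono_adjacent` [folklore].
-/

namespace Summit.CriticalPhenomena.Ising3D.Control2D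

open Set Finset
open Literature.MathematicalPhysics.QuantumFieldTheory.ConformalBootstrap3D

/-! ### The term of one evaluation datum and its convexity -/

/-- The contribution of one evaluation datum to `Φ_j(E)` without its sign:
`fM c x y j E = c (x^j + y^j) (xy)^{(E-j)/2}` (`= c · pairPow a b (x,y)` for `a + b = E`, `|a-b| = j`).
[folklore] -/
noncomputable def fM (c x y : ℝ) (j : ℕ) (E : ℝ) : ℝ :=
  c * (x ^ j + y ^ j) * (x * y) ^ ((E - j) / 2)

/-- `fM ≥ 0` for `c ≥ 0`, `x, y > 0`. [folklore] -/
theorem fM_nonneg {c x y : ℝ} (hc : 0 ≤ c) (hx : 0 < x) (hy : 0 < y) (j : ℕ) (E : ℝ) :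
    0 ≤ fM c x y j E := by
  unfold fM; positivity

/-- **Convexity in `E`**: `fM c x y j` is convex on `ℝ` (`c ≥ 0`, `x, y > 0`): it is a non-negative
multiple of `E ↦ b^E`, `b = √(xy)`. [folklore] -/
theorem convexOn_fM {c x y : ℝ} (hc : 0 ≤ c) (hx : 0 < x) (hy : 0 < y) (j : ℕ) :
    ConvexOn ℝ univ (fM c x y j) := by
  have hxy : 0 < x * y := mul_pos hx hy
  set b : ℝ := (x * y) ^ ((1 : ℝ) / 2) with hb
  have hb0 : 0 < b := Real.rpow_pos_of_pos hxy _
  have hconv := convexOn_rpow_left hb0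
  have key : ∀ E : ℝ, fM c x y j E = (c * (x ^ j + y ^ j) * b ^ (-(j : ℝ))) • b ^ E := by
    intro E
    simp only [fM, smul_eq_mul, hb]
    rw [← Real.rpow_mul hxy.le, ← Real.rpow_mul hxy.le, mul_assoc (c * (x ^ j + y ^ j)),
      ← Real.rpow_add hxy]
    congr 1
    ring_nf
  have hcoef : 0 ≤ c * (x ^ j + y ^ j) * b ^ (-(j : ℝ)) := by positivity
  have := hconv.smul hcoef
  refine ⟨convex_univ, fun E _ E' _ p q hp hq hpq => ?_⟩
  have h := this.2 (mem_univ E) (mem_univ E') hp hq hpq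
  simp only [key, smul_eq_mul] at h ⊢
  exact h

/-! ### Real evaluation data and the signed sums -/

/-- One real evaluation datum: sign, coefficient magnitude `c = |c_d|`, coordinates `(x, y)`.
[folklore] -/
structure RDat where
  /-- `true` for `σ_d = +1`, `false` for `σ_d = -1` -/
  σ : Bool
  /-- `|c_d|` -/
  c : ℝ
  /-- first coordinate of the evaluation point -/
  x : ℝ
  /-- second coordinate -/
  y : ℝ

/-- Admissible datum: `c ≥ 0` and the point in the open square. [folklore] -/
def RDat.ok (d : RDat) : Prop := 0 ≤ d.c ∧ 0 < d.x ∧ d.x < 1 ∧ 0 < d.y ∧ d.y < 1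

/-- The positive part `F = Σ_{σ=+} f_d`. [folklore] -/
noncomputable def Fpos (rds : List RDat) (j : ℕ) (E : ℝ) : ℝ :=
  (rds.map fun d => if d.σ then fM d.c d.x d.y j E else 0).sum

/-- The negative part `G = Σ_{σ=-} f_d`. [folklore] -/
noncomputable def Fneg (rds : List RDat) (j : ℕ) (E : ℝ) : ℝ :=
  (rds.map fun d => if d.σ then 0 else fM d.c d.x d.y j E).sum

/-- The signed sum `Φ_j(E) = Σ_d σ_d f_d(E)`. [folklore] -/
noncomputable def Phi (rds : List RDat) (j : ℕ) (E : ℝ) : ℝ :=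
  (rds.map fun d => (if d.σ then (1 : ℝ) else -1) * fM d.c d.x d.y j E).sum

/-- `Φ = F - G`. [folklore] -/
theorem Phi_eq (rds : List RDat) (j : ℕ) (E : ℝ) : Phi rds j E = Fpos rds j E - Fneg rds j E := by
  induction rds with
  | nil => simp [Phi, Fpos, Fneg]
  | cons d tl ih =>
    simp only [Phi, Fpos, Fneg, List.map_cons, List.sum_cons] at ih ⊢
    rw [ih]
    cases d.σ <;> simp <;> ring

/-- The zero function is convex (stated with the scalar action by multiplication, as `ConvexOn.add`
produces it). [folklore] -/
theorem convexOn_zero_real : ConvexOn ℝ univ (fun _ : ℝ => (0 : ℝ)) :=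
  ⟨convex_univ, fun _ _ _ _ _ _ _ _ _ => by simp⟩

/-- `F` is convex for admissible data. [folklore] -/
theorem convexOn_Fpos {rds : List RDat} (h : ∀ d ∈ rds, d.ok) (j : ℕ) :
    ConvexOn ℝ univ (Fpos rds j) := by
  induction rds with
  | nil => exact ⟨convex_univ, fun _ _ _ _ _ _ _ _ _ => by simp [Fpos]⟩
  | cons d tl ih =>
    have htl : ∀ d' ∈ tl, d'.ok := fun d' hd' => h d' (List.mem_cons_of_mem _ hd')
    have hd := h d List.mem_cons_self
    have h1 : ConvexOn ℝ univ (fun E => if d.σ then fM d.c d.x d.y j E else 0) := by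
      cases d.σ
      · simpa using convexOn_zero_real
      · simpa using convexOn_fM hd.1 hd.2.1 hd.2.2.2.1 j
    have h2 := h1.add (ih htl)
    refine ⟨convex_univ, fun a _ b _ p q hp hq hpq => ?_⟩
    have := h2.2 (mem_univ a) (mem_univ b) hp hq hpq
    simpa [Fpos, List.map_cons, List.sum_cons, smul_eq_mul] using this

/-- `G` is convex for admissible data. [folklore] -/
theorem convexOn_Fneg {rds : List RDat} (h : ∀ d ∈ rds, d.ok) (j : ℕ) :
    ConvexOn ℝ univ (Fneg rds j) := by
  induction rds with
  | nil => exact ⟨convex_univ, fun _ _ _ _ _ _ _ _ _ => by simp [Fneg]⟩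
  | cons d tl ih =>
    have htl : ∀ d' ∈ tl, d'.ok := fun d' hd' => h d' (List.mem_cons_of_mem _ hd')
    have hd := h d List.mem_cons_self
    have h1 : ConvexOn ℝ univ (fun E => if d.σ then 0 else fM d.c d.x d.y j E) := by
      cases d.σ
      · simpa using convexOn_fM hd.1 hd.2.1 hd.2.2.2.1 j
      · simpa using convexOn_zero_real
    have h2 := h1.add (ih htl)
    refine ⟨convex_univ, fun a _ b _ p q hp hq hpq => ?_⟩
    have := h2.2 (mem_univ a) (mem_univ b) hp hq hpq
    simpa [Fneg, List.map_cons, List.sum_cons, smul_eq_mul] using this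

/-- `G ≥ 0` for admissible data. [folklore] -/
theorem Fneg_nonneg {rds : List RDat} (h : ∀ d ∈ rds, d.ok) (j : ℕ) (E : ℝ) : 0 ≤ Fneg rds j E := by
  induction rds with
  | nil => simp [Fneg]
  | cons d tl ih =>
    have htl : ∀ d' ∈ tl, d'.ok := fun d' hd' => h d' (List.mem_cons_of_mem _ hd')
    have hd := h d List.mem_cons_self
    have ih' := ih htl
    simp only [Fneg, List.map_cons, List.sum_cons] at ih' ⊢
    have : 0 ≤ (if d.σ then 0 else fM d.c d.x d.y j E) := by
      cases d.σ
      · simpa using fM_nonneg hd.1 hd.2.1 hd.2.2.2.1 j E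
      · simp
    linarith

/-! ### The cell lemma -/

/-- **The log-free second-order cell test.** For convex `F, G : ℝ → ℝ` and a cell `[c, c+H]`, `H > 0`:
if `G(c+H) ≤ F(c+H)` and `F(c+2H) + G(c) ≤ 2 F(c+H)` then `G ≤ F` on `[c, c+H]`
(three-slope inequality for `F` at `E ≤ c+H < c+2H`, chord inequality for `G` on `[c, c+H]`).
PROVED. [folklore] -/
theorem cell_nonneg_of_convex {F G : ℝ → ℝ} (hF : ConvexOn ℝ univ F) (hG : ConvexOn ℝ univ G)
    {c H : ℝ} (hH : 0 < H) (h1 : G (c + H) ≤ F (c + H)) (h2 : F (c + 2 * H) + G c ≤ 2 * F (c + H))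
    {E : ℝ} (hE : E ∈ Icc c (c + H)) : G E ≤ F E := by
  obtain ⟨hcE, hEc⟩ := hE
  -- chord bound for G on [c, c+H]:  H · G(E) ≤ (c+H-E) G(c) + (E-c) G(c+H)
  have hG' : H * G E ≤ (c + H - E) * G c + (E - c) * G (c + H) := by
    rcases eq_or_lt_of_le hcE with h | hlt
    · subst h; nlinarith
    rcases eq_or_lt_of_le hEc with h' | hlt'
    · rw [h']; nlinarith
    have := hG.secant_mono_aux1 (mem_univ c) (mem_univ (c + H)) hlt hlt'
    have e : c + H - c = H := by ring
    rw [e] at this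
    linarith
  -- three-slope bound for F at E ≤ c+H < c+2H:  H · F(E) ≥ H F(c+H) + (c+H-E)(F(c+H) - F(c+2H))
  have hF' : H * F (c + H) + (c + H - E) * (F (c + H) - F (c + 2 * H)) ≤ H * F E := by
    rcases eq_or_lt_of_le hEc with h' | hlt'
    · rw [h']; nlinarith
    have := hF.secant_mono_aux1 (mem_univ E) (mem_univ (c + 2 * H)) hlt' (by linarith)
    -- (c+2H-E) F(c+H) ≤ (c+2H-(c+H)) F(E) + (c+H-E) F(c+2H)
    have e : c + 2 * H - (c + H) = H := by ring
    rw [e] at this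
    nlinarith
  -- combine with θ = (c+H-E)/H ∈ [0,1]
  have hθ0 : 0 ≤ c + H - E := by linarith
  have hθ1 : 0 ≤ E - c := by linarith
  nlinarith [mul_nonneg hθ0 (sub_nonneg.2 h2), mul_nonneg hθ1 (sub_nonneg.2 h1)]

/-! ### Covering lemmas -/

/-- Unit cover: `E ∈ [A, A + n)` lies in `[A + i, A + i + 1]` for some `i < n`. [folklore] -/
theorem exists_unit_cell {A E : ℝ} {n : ℕ} (h1 : A ≤ E) (h2 : E < A + n) :
    ∃ i : ℕ, i < n ∧ A + i ≤ E ∧ E ≤ A + i + 1 := by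
  have hn : 1 ≤ n := by
    by_contra h
    have : n = 0 := by omega
    subst this; simp at h2; linarith
  obtain ⟨i, hi, hi1, hi2⟩ := exists_step_of_mem_Icc (fun i => A + i) hn (by simpa using h1)
    (by simpa using h2.le)
  exact ⟨i, hi, hi1, by simpa [add_assoc] using hi2⟩

/-- Dyadic sub-cover: `E ∈ [A, A + 1]` lies in `[A + k/2^r, A + (k+1)/2^r]` for some `k < 2^r`.
[folklore] -/
theorem exists_fine_cell {A E : ℝ} (r : ℕ) (h1 : A ≤ E) (h2 : E ≤ A + 1) :
    ∃ k : ℕ, k < 2 ^ r ∧ A + k / 2 ^ r ≤ E ∧ E ≤ A + (k + 1) / 2 ^ r := by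
  have h2r : (0 : ℝ) < 2 ^ r := pow_pos two_pos r
  have hN' : E ≤ A + ((2 ^ r : ℕ) : ℝ) / 2 ^ r := by
    rw [Nat.cast_pow, Nat.cast_two, div_self h2r.ne']; exact h2
  obtain ⟨k, hk, hk1, hk2⟩ := exists_step_of_mem_Icc (fun k => A + k / 2 ^ r) Nat.one_le_two_pow
    (by simpa using h1) hN'
  exact ⟨k, hk, hk1, by simpa using hk2⟩

/-! ### From `φ[F_-[pairPow a b]]` to `Φ_j(E)` -/

/-- The pair monomial with `|a - b| = j`, `a + b = E`: `pairPow a b x y = (x^j + y^j)(xy)^{(E-j)/2}`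
for `x, y > 0`. [folklore] -/
theorem pairPow_eq_fM {a b x y : ℝ} (hx : 0 < x) (hy : 0 < y) {j : ℕ}
    (hj : a - b = j ∨ b - a = j) : pairPow a b x y = (x ^ j + y ^ j) * (x * y) ^ ((a + b - j) / 2) := by
  rcases hj with h | h
  · have ha : a = b + j := by linarith
    have ht : (a + b - j) / 2 = b := by linarith
    rw [ht, ha, pairPow_eq_of_nat hx hy j]; ring
  · have hb : b = a + j := by linarith
    have ht : (a + b - j) / 2 = a := by linarith
    rw [ht, pairPow_comm, hb, pairPow_eq_of_nat hx hy j]; ring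

/-- The real evaluation data of a point functional with rational nodes/weights at `Δ_σ = 1/8`:
direct data `(σ = [0 ≤ w_k], |w_k| v_k^{1/8}, z_k, z̄_k)` followed by reflected data
`(σ = [w_k ≤ 0], |w_k| u_k^{1/8}, 1-z_k, 1-z̄_k)`. [folklore] -/
noncomputable def realData {n : ℕ} (w z zb : Fin n → ℚ) : List RDat :=
  (List.ofFn fun k => (⟨decide (0 ≤ w k),
      |((w k : ℚ) : ℝ)| * ((1 - ((z k : ℚ) : ℝ)) * (1 - ((zb k : ℚ) : ℝ))) ^ ((1 : ℝ) / 8),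
      ((z k : ℚ) : ℝ), ((zb k : ℚ) : ℝ)⟩ : RDat)) ++
  (List.ofFn fun k => (⟨decide (w k ≤ 0),
      |((w k : ℚ) : ℝ)| * (((z k : ℚ) : ℝ) * ((zb k : ℚ) : ℝ)) ^ ((1 : ℝ) / 8),
      1 - ((z k : ℚ) : ℝ), 1 - ((zb k : ℚ) : ℝ)⟩ : RDat))

/-- The real data of a certificate with nodes in the open square are admissible. [folklore] -/
theorem realData_ok {n : ℕ} (w z zb : Fin n → ℚ) (hz : ∀ k, 0 < z k ∧ z k < 1)
    (hzb : ∀ k, 0 < zb k ∧ zb k < 1) : ∀ d ∈ realData w z zb, d.ok := by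
  intro d hd
  simp only [realData, List.mem_append, List.mem_ofFn] at hd
  rcases hd with ⟨k, rfl⟩ | ⟨k, rfl⟩
  · have h1 := hz k; have h2 := hzb k
    have b1 : (0 : ℝ) < ((z k : ℚ) : ℝ) := by exact_mod_cast h1.1
    have b2 : ((z k : ℚ) : ℝ) < 1 := by exact_mod_cast h1.2
    have b3 : (0 : ℝ) < ((zb k : ℚ) : ℝ) := by exact_mod_cast h2.1
    have b4 : ((zb k : ℚ) : ℝ) < 1 := by exact_mod_cast h2.2
    refine ⟨?_, b1, b2, b3, b4⟩
    exact mul_nonneg (abs_nonneg _)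
      (Real.rpow_nonneg (mul_nonneg (by linarith) (by linarith)) _)
  · have h1 := hz k; have h2 := hzb k
    have b1 : (0 : ℝ) < ((z k : ℚ) : ℝ) := by exact_mod_cast h1.1
    have b2 : ((z k : ℚ) : ℝ) < 1 := by exact_mod_cast h1.2
    have b3 : (0 : ℝ) < ((zb k : ℚ) : ℝ) := by exact_mod_cast h2.1
    have b4 : ((zb k : ℚ) : ℝ) < 1 := by exact_mod_cast h2.2
    refine ⟨?_, by show (0:ℝ) < 1 - _; linarith, by show (1:ℝ) - _ < 1; linarith,
      by show (0:ℝ) < 1 - _; linarith, by show (1:ℝ) - _ < 1; linarith⟩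
    exact mul_nonneg (abs_nonneg _) (Real.rpow_nonneg (mul_nonneg b1.le b3.le) _)

/-- One node of the identity `φ[F_-[pairPow a b]] = Φ_j(a+b)`: the signed split of
`w (V P₁ - U P₂)` into `σ₁ |w| V P₁ + σ₂ |w| U P₂`. [folklore] -/
theorem node_split (w : ℚ) (V U P₁ P₂ : ℝ) :
    (w : ℝ) * (V * P₁ + (-1) * U * P₂) =
      (if decide (0 ≤ w) then (1 : ℝ) else -1) * (|(w : ℝ)| * V * P₁) +
        (if decide (w ≤ 0) then (1 : ℝ) else -1) * (|(w : ℝ)| * U * P₂) := by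
  by_cases hw : 0 ≤ w
  · have hw' : (0 : ℝ) ≤ (w : ℝ) := by exact_mod_cast hw
    rw [abs_of_nonneg hw']
    by_cases hw0 : w ≤ 0
    · have : w = 0 := le_antisymm hw0 hw
      simp [this]
    · simp [hw, hw0]; ring
  · have hw' : (w : ℝ) < 0 := by exact_mod_cast (lt_of_not_ge hw)
    have hw0 : w ≤ 0 := le_of_lt (lt_of_not_ge hw)
    rw [abs_of_neg hw']
    simp [hw, hw0]; ring

/-- **`φ[F_-[pairPow a b]] = Φ_j(a+b)`** for the point functional with rational nodes/weights at
`Δ_σ = 1/8`, `j = |a - b|` (nodes in the open square). [folklore] -/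
theorem pointFunctional_pairPow_eq_Phi {n : ℕ} (w z zb : Fin n → ℚ) (hz : ∀ k, 0 < z k ∧ z k < 1)
    (hzb : ∀ k, 0 < zb k ∧ zb k < 1) {a b : ℝ} {j : ℕ} (hj : a - b = j ∨ b - a = j) :
    pointFunctional (fun k => ((w k : ℚ) : ℝ)) (fun k => ((z k : ℚ) : ℝ)) (fun k => ((zb k : ℚ) : ℝ))
        (crossF (1 / 8) (-1) (pairPow a b)) =
      Phi (realData w z zb) j (a + b) := by
  rw [pointFunctional_apply, Phi, realData, List.map_append, List.sum_append, List.map_ofFn,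
    List.map_ofFn, List.sum_ofFn, List.sum_ofFn, ← Finset.sum_add_distrib]
  refine Finset.sum_congr rfl fun k _ => ?_
  have h1 := hz k; have h2 := hzb k
  have hx : (0 : ℝ) < ((z k : ℚ) : ℝ) := by exact_mod_cast h1.1
  have hy : (0 : ℝ) < ((zb k : ℚ) : ℝ) := by exact_mod_cast h2.1
  have hx' : (0 : ℝ) < 1 - ((z k : ℚ) : ℝ) := by
    have : ((z k : ℚ) : ℝ) < 1 := by exact_mod_cast h1.2
    linarith
  have hy' : (0 : ℝ) < 1 - ((zb k : ℚ) : ℝ) := by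
    have : ((zb k : ℚ) : ℝ) < 1 := by exact_mod_cast h2.2
    linarith
  simp only [Function.comp_apply, crossF, fM, pairPow_eq_fM hx hy hj, pairPow_eq_fM hx' hy' hj]
  have e18 : ((1 : ℝ) / 8) = (1 / 8 : ℝ) := rfl
  have := node_split (w k) ((((1 - ((z k : ℚ) : ℝ)) * (1 - ((zb k : ℚ) : ℝ))) ^ ((1 : ℝ) / 8)))
    (((((z k : ℚ) : ℝ) * ((zb k : ℚ) : ℝ)) ^ ((1 : ℝ) / 8)))
    ((((z k : ℚ) : ℝ) ^ j + ((zb k : ℚ) : ℝ) ^ j) *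
      (((z k : ℚ) : ℝ) * ((zb k : ℚ) : ℝ)) ^ ((a + b - j) / 2))
    (((1 - ((z k : ℚ) : ℝ)) ^ j + (1 - ((zb k : ℚ) : ℝ)) ^ j) *
      ((1 - ((z k : ℚ) : ℝ)) * (1 - ((zb k : ℚ) : ℝ))) ^ ((a + b - j) / 2))
  rw [e18] at this
  linear_combination this

end Summit.CriticalPhenomena.Ising3D.Control2D
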